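/-
Copyright: lit-balaban cell (HOME `run/shared/lean/pub/lit-balaban/`), Phase-2 proof seat p12 (gen 12).  The proofs reproduce the
printed argument; nothing is claimed beyond what the kernel checks below.
-/
import Mathlib.Analysis.CStarAlgebra.ContinuousFunctionalCalculus.Order
import Mathlib.Analysis.SpecialFunctions.ContinuousFunctionalCalculus.Rpow.Basic
import Mathlib.Analysis.InnerProductSpace.StarOrder
import Mathlib.Analysis.CStarAlgebra.ContinuousLinearMap
import Literature.MathematicalPhysics.QuantumFieldTheory.DybalskiStottmeisterTanimoto2024.DST24Configurations

/-!
# `DybalskiStottmeisterTanimoto2024.DST24SquareRootLemma` — [DybalskiStottmeisterTanimoto2024] **Appendix B, Lemma (square-root)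
# AS PRINTED, for self-adjoint OPERATORS**: `‖(1+M)^{1/2} − 1‖_op ≤ c_{1/2}‖M‖_op` for `M = M*`, `‖M‖_op < 1/2` — PROVED

statement-level skeleton of published theorems with citation tags; proofs where landed; nothing here is a claim about
the Yang–Mills mass gap

W. Dybalski, A. Stottmeister, Y. Tanimoto, *The Bałaban variational problem in the non-linear sigma model*, Rev. Math. Phys.
**36** (2024), arXiv:2403.09800; source held `paper:arxiv-2403.09800` (Appendix B «Some technical lemmas» = tex chunk p0023,
second lemma, L37–L61).  Unit `lit-balaban-p12` (gen 12).  The tree's `DST24Configurations` (p12 gen 7) holds the lemma in the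
SCALAR form in which §2.2 applies it (`abs_sqrt_sub_one_le`, `abs_inv_sqrt_sub_one_le`: for `G₀ = SU(2)` the operator
`𝒞₀*𝒞₀` is a non-negative multiple of `1`) together with the print's constant `c_{1/2} = ch = π√2/(√2+1)` (`one_le_ch`).  This file
proves the lemma in the generality in which it is PRINTED — a self-adjoint operator on a Hilbert space.

WHAT IS PRINTED (App. B, p0023 L37–L41).  «**Lemma.** Let `M` be a self-adjoint operator on a Hilbert space with `‖M‖_op < 1/2`.
Then `‖(1+M)^{1/2} − 1‖_op ≤ c_{1/2}‖M‖_op`, where `c_{1/2} ≥ 1` is a numerical constant and `‖·‖_op` is the operator norm.»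
Printed proof (L43–L61): the resolvent integral `(1+M)^{−1/2} = π⁻¹∫₀^∞ dy y^{−1/2}(y+1+M)⁻¹`, whence
`(1+M)^{1/2} − 1 = π⁻¹∫₀^∞ dy (√y(y+1))⁻¹ · My(y+1+M)⁻¹` and `‖(1+M)^{1/2} − 1‖ ≤ ‖M‖∫₀^∞ dy √y/((y+1)(y+½)) = c_{1/2}‖M‖`
(using `‖(y+1+M)⁻¹‖ ≤ (y+½)⁻¹`).

WHAT IS PROVED HERE, and how (a genuinely shorter road, stated as the house rule asks: Mathlib's continuous functional calculus
replaces the resolvent integral — both define the same operator `(1+M)^{1/2}`, cf. `sqrt_one_add_eq_cfc`).  In any unital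
C⋆-algebra `A` (in particular `A = 𝓑(𝓗)`), for `M` self-adjoint with `‖M‖ ≤ 1/2`:
* `abs_le_norm_of_mem_spectrum` — `σ(M) ⊆ [−‖M‖, ‖M‖]`;
* `abs_sqrt_one_add_sub_one_le` — the scalar estimate on the spectrum, `|√(1+x) − 1| ≤ c_{1/2}·r` for `|x| ≤ r ≤ 1/2`
  (from `DST24Configurations.abs_sqrt_sub_one_le`; in fact `|√(1+x) − 1| ≤ |x|` and `c_{1/2} ≥ 1`);
* **`norm_cfc_sqrt_one_add_sub_one_le`** — `‖f(M) − 1‖ ≤ c_{1/2}‖M‖` for `f(t) = √(1+t)` applied by the functional calculus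
  (`norm_cfc_le`: the norm of `g(M)` is the sup of `|g|` over `σ(M)`);
* `cfc_sqrt_one_add_mul_self` — `f(M)·f(M) = 1 + M` (so `f(M)` IS the square root), `isSelfAdjoint_cfc_sqrt_one_add`;
* with an order structure making `A` a star-ordered ring (every C⋆-algebra of operators; Mathlib: `[PartialOrder A]
  [StarOrderedRing A]`): `cfc_sqrt_one_add_nonneg` (`f(M) ≥ 0`), **`sqrt_one_add_eq_cfc`** (`CFC.sqrt (1 + M) = f(M)`, Mathlib's
  positive square root, by uniqueness of non-negative square roots) and **`square_root_lemma`**: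
  `‖CFC.sqrt (1 + M) − 1‖ ≤ c_{1/2}‖M‖` for `‖M‖ < 1/2` — the lemma AS PRINTED;
* **`square_root_lemma_hilbert`** — the literal instance: `M : 𝓗 →L[ℂ] 𝓗` self-adjoint on a complex Hilbert space `𝓗`,
  `‖M‖ < 1/2` ⇒ `‖(1+M)^{1/2} − 1‖ ≤ c_{1/2}‖M‖` (Loewner order, `ContinuousLinearMap.instStarOrderedRing`).
No `def`, no named facts.  Nothing here refers to or asserts anything about Bałaban's papers.
[cite: DybalskiStottmeisterTanimoto2024, App. B Lemma (square-root)]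
-/

namespace Literature.MathematicalPhysics.QuantumFieldTheory.DybalskiStottmeisterTanimoto2024.DST24SquareRootLemma

open Literature.MathematicalPhysics.QuantumFieldTheory.DybalskiStottmeisterTanimoto2024.DST24Configurations
  (ch one_le_ch ch_pos abs_sqrt_sub_one_le)

section CStar

variable {A : Type*} [CStarAlgebra A]

/-- The (real) spectrum of an element of a unital C⋆-algebra lies in `[−‖M‖, ‖M‖]`.
[cite: DybalskiStottmeisterTanimoto2024, App. B Lemma (square-root), proof («`‖(y+1+M)⁻¹‖_op ≤ (y+1/2)⁻¹`»)] -/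
theorem abs_le_norm_of_mem_spectrum {M : A} {x : ℝ} (hx : x ∈ spectrum ℝ M) : |x| ≤ ‖M‖ := by
  rcases subsingleton_or_nontrivial A with hA | hA
  · simp [spectrum.of_subsingleton] at hx
  · rw [← Real.norm_eq_abs]; exact spectrum.norm_le_norm_of_mem hx

/-- The scalar estimate on the spectrum: `|√(1+x) − 1| ≤ c_{1/2}·r` whenever `|x| ≤ r ≤ 1/2` (indeed `≤ |x| ≤ r`, `c_{1/2} ≥ 1`).
[cite: DybalskiStottmeisterTanimoto2024, App. B Lemma (square-root)] -/
theorem abs_sqrt_one_add_sub_one_le {x r : ℝ} (hx : |x| ≤ r) (hr : r ≤ 1 / 2) :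
    |Real.sqrt (1 + x) - 1| ≤ ch * r := by
  have h1 : |(1 + x) - 1| ≤ 1 / 2 := by rw [add_sub_cancel_left]; exact hx.trans hr
  calc |Real.sqrt (1 + x) - 1| ≤ ch * |(1 + x) - 1| := abs_sqrt_sub_one_le h1
    _ = ch * |x| := by rw [add_sub_cancel_left]
    _ ≤ ch * r := mul_le_mul_of_nonneg_left hx ch_pos.le

/-- **Lemma (square-root), functional-calculus form.**  For `M` self-adjoint with `‖M‖ ≤ 1/2`, the operator `f(M)`,
`f(t) = √(1+t)` (continuous functional calculus), satisfies `‖f(M) − 1‖ ≤ c_{1/2}‖M‖`.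
[cite: DybalskiStottmeisterTanimoto2024, App. B Lemma (square-root)] -/
theorem norm_cfc_sqrt_one_add_sub_one_le {M : A} (hM : IsSelfAdjoint M) (hn : ‖M‖ ≤ 1 / 2) :
    ‖cfc (fun t : ℝ => Real.sqrt (1 + t)) M - 1‖ ≤ ch * ‖M‖ := by
  have hf : ContinuousOn (fun t : ℝ => Real.sqrt (1 + t)) (spectrum ℝ M) :=
    (Real.continuous_sqrt.comp (continuous_const.add continuous_id)).continuousOn
  have e : cfc (fun t : ℝ => Real.sqrt (1 + t)) M - 1 = cfc (fun t : ℝ => Real.sqrt (1 + t) - 1) M := by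
    rw [cfc_sub (fun t : ℝ => Real.sqrt (1 + t)) (fun _ : ℝ => (1 : ℝ)) M hf continuousOn_const, cfc_const_one ℝ M]
  rw [e]
  refine norm_cfc_le (mul_nonneg ch_pos.le (norm_nonneg _)) fun x hx => ?_
  rw [Real.norm_eq_abs]
  exact abs_sqrt_one_add_sub_one_le (abs_le_norm_of_mem_spectrum hx) hn

/-- `f(M)` is self-adjoint. [cite: DybalskiStottmeisterTanimoto2024, App. B Lemma (square-root)] -/
theorem isSelfAdjoint_cfc_sqrt_one_add (M : A) : IsSelfAdjoint (cfc (fun t : ℝ => Real.sqrt (1 + t)) M) :=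
  cfc_predicate _ M

/-- `f(M)·f(M) = 1 + M` for `M` self-adjoint with `‖M‖ ≤ 1/2` (on `σ(M) ⊆ [−½, ½]`, `√(1+x)² = 1 + x`): `f(M)` is a square root
of `1 + M`. [cite: DybalskiStottmeisterTanimoto2024, App. B Lemma (square-root) («`(1+M)^{1/2}`»)] -/
theorem cfc_sqrt_one_add_mul_self {M : A} (hM : IsSelfAdjoint M) (hn : ‖M‖ ≤ 1 / 2) :
    cfc (fun t : ℝ => Real.sqrt (1 + t)) M * cfc (fun t : ℝ => Real.sqrt (1 + t)) M = 1 + M := by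
  have hf : ContinuousOn (fun t : ℝ => Real.sqrt (1 + t)) (spectrum ℝ M) :=
    (Real.continuous_sqrt.comp (continuous_const.add continuous_id)).continuousOn
  rw [← cfc_mul (fun t : ℝ => Real.sqrt (1 + t)) (fun t : ℝ => Real.sqrt (1 + t)) M hf hf]
  have hcongr : (spectrum ℝ M).EqOn (fun t : ℝ => Real.sqrt (1 + t) * Real.sqrt (1 + t)) (fun t : ℝ => 1 + t) := by
    intro x hx
    have hx' : |x| ≤ 1 / 2 := (abs_le_norm_of_mem_spectrum hx).trans hn
    have h0 : 0 ≤ 1 + x := by rw [abs_le] at hx'; linarith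
    exact Real.mul_self_sqrt h0
  rw [cfc_congr hcongr, cfc_const_add (1 : ℝ) (fun t : ℝ => t) M continuousOn_id hM, map_one, cfc_id' ℝ M hM]

section Ordered

variable [PartialOrder A] [StarOrderedRing A]

/-- `f(M) ≥ 0` (its spectral values `√(1+x)` are non-negative). [cite: DybalskiStottmeisterTanimoto2024, App. B Lemma (square-root)] -/
theorem cfc_sqrt_one_add_nonneg (M : A) : 0 ≤ cfc (fun t : ℝ => Real.sqrt (1 + t)) M :=
  cfc_nonneg fun _ _ => Real.sqrt_nonneg _

/-- The print's `(1+M)^{1/2}` — the positive square root of the positive operator `1 + M` (Mathlib `CFC.sqrt`) — IS `f(M)`,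
`f(t) = √(1+t)`, for `M` self-adjoint with `‖M‖ ≤ 1/2` (uniqueness of non-negative square roots).
[cite: DybalskiStottmeisterTanimoto2024, App. B Lemma (square-root) («the standard representation `(1+M)^{−1/2} = π⁻¹∫₀^∞ dy y^{−1/2}(y+1+M)⁻¹`»)] -/
theorem sqrt_one_add_eq_cfc {M : A} (hM : IsSelfAdjoint M) (hn : ‖M‖ ≤ 1 / 2) :
    CFC.sqrt (1 + M) = cfc (fun t : ℝ => Real.sqrt (1 + t)) M :=
  CFC.sqrt_unique (cfc_sqrt_one_add_mul_self hM hn) (cfc_sqrt_one_add_nonneg M)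

/-- **Appendix B, Lemma (square-root), AS PRINTED.** «Let `M` be a self-adjoint operator on a Hilbert space with `‖M‖_op < 1/2`.
Then `‖(1+M)^{1/2} − 1‖_op ≤ c_{1/2}‖M‖_op`, where `c_{1/2} ≥ 1` is a numerical constant» — here in any unital C⋆-algebra which is
a star-ordered ring (e.g. `𝓑(𝓗)`), `(1+M)^{1/2} = CFC.sqrt (1 + M)`, `c_{1/2} = ch = π√2/(√2+1)`.
[cite: DybalskiStottmeisterTanimoto2024, App. B Lemma (square-root)] -/
theorem square_root_lemma {M : A} (hM : IsSelfAdjoint M) (hn : ‖M‖ < 1 / 2) :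
    ‖CFC.sqrt (1 + M) - 1‖ ≤ ch * ‖M‖ := by
  rw [sqrt_one_add_eq_cfc hM hn.le]
  exact norm_cfc_sqrt_one_add_sub_one_le hM hn.le

end Ordered

end CStar

section Hilbert

variable {H : Type*} [NormedAddCommGroup H] [InnerProductSpace ℂ H] [CompleteSpace H]

/-- **Appendix B, Lemma (square-root), the literal instance**: a bounded self-adjoint operator `M` on a complex Hilbert space `𝓗`
with `‖M‖ < 1/2` satisfies `‖(1+M)^{1/2} − 1‖ ≤ c_{1/2}‖M‖` (operator norm; `(1+M)^{1/2}` the positive square root for the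
Loewner order). [cite: DybalskiStottmeisterTanimoto2024, App. B Lemma (square-root)] -/
theorem square_root_lemma_hilbert {M : H →L[ℂ] H} (hM : IsSelfAdjoint M) (hn : ‖M‖ < 1 / 2) :
    ‖CFC.sqrt (1 + M) - 1‖ ≤ ch * ‖M‖ :=
  square_root_lemma hM hn

/-- «`c_{1/2} ≥ 1` is a numerical constant»: with the explicit value one may take `c_{1/2} = 2` (or any number `≥ ch ≈ 1.84`).
[cite: DybalskiStottmeisterTanimoto2024, App. B Lemma (square-root)] -/
theorem square_root_lemma_hilbert_two {M : H →L[ℂ] H} (hM : IsSelfAdjoint M) (hn : ‖M‖ < 1 / 2) :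
    ‖CFC.sqrt (1 + M) - 1‖ ≤ 2 * ‖M‖ := by
  refine (square_root_lemma_hilbert hM hn).trans (mul_le_mul_of_nonneg_right ?_ (norm_nonneg _))
  -- `ch = π√2/(√2+1) ≤ 2` since `π√2 ≤ 2√2 + 2`, i.e. `(π − 2)√2 ≤ 2`
  unfold ch
  have h2 : Real.sqrt 2 < 3 / 2 := (Real.sqrt_lt' (by norm_num)).mpr (by norm_num)
  have h2' : 0 ≤ Real.sqrt 2 := Real.sqrt_nonneg 2
  have hπ := Real.pi_lt_d2
  rw [div_le_iff₀ (by positivity)]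
  nlinarith

end Hilbert

end Literature.MathematicalPhysics.QuantumFieldTheory.DybalskiStottmeisterTanimoto2024.DST24SquareRootLemma
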